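import Summits.QuantumFields.QCD.Theorems.SpectralDefectExtinctionChiralDescentChiralPointEquivalence
import Summits.QuantumFields.QCD.Theses.QuarksAsStableAction

/-!
# `ChiralDescent` (crux stmt-QuantumFields-17527, route SpectralDefectExtinction) IS the shared chiral item of the
# heavy-threshold family — cross-route identifications, kernel-checked (line `Sketch`, lead c4, cycle 5, 2026-08-17)

Four lead cycles reduced the crux to ONE residual statement E (`stub_chiralPointOfThreshold` of
`Cruxes/ChiralDescent/Lines/Sketch.lean`; closer `chiralDescent_of_chiralPointOfThreshold`, p137636): every mass-scaling
regularisation carrying the body of the re-typed conjunct above some threshold carries it above an offset at which it has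
NO uniform lattice rate.  This file records, WITHOUT any new definition, that neither the crux nor E is new on the ledger —
both already exist, verbatim up to packaging, as items of sibling routes of the sub-problem `QCD` — so that whichever of
them lands first closes this crux by one line, and no planner needs to file E again:

* `chiralDescent_iff_chiralCompletion` — the CRUX ITSELF is the shared item stmt-QuantumFields-17394
  (`QuarksAsStableAction.ChiralCompletion`; same text as `SeaNonGibbs.ChiralCompletion`):
  `∀ N_f ∈ {2,3}, (∃ M₀ ≥ 0, ∃ reg mass-scaling, body above M₀) → QCDOf N_f` — swap `∃ reg` and `∃ M₀`.
* `chiralPointOfThreshold_iff_sameRegChiralCompletion` — E is the crux stmt-QuantumFields-17661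
  (`HeavyThresholdYMBridge.ChiralCompletion`, the SAME-REGULARISATION form: some constant re-pin `m ↦ m + δ` of the given
  regularisation is chiral at zero and carries the body at every positive tuple; its text is repeated VERBATIM on the
  right-hand side, so this file does not import that route) — `δ ↔ μ`, tuples translated by `δ`.
* `chiralPointOfThreshold_of_massContinuation_of_chiralTupleGapless` — E follows from the pair
  stmt-QuantumFields-18327 `QuarksAsStableAction.MassContinuation` (the massive phase is OPEN below a uniformly gapped
  threshold) ∧ stmt-QuantumFields-18328 `QuarksAsStableAction.ChiralTupleGapless` (some tuple has no lattice gap at any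
  rate): the gapless tuple bounds the body up-set `{μ | body above μ}` from below (a body at that tuple would gap it —
  `HasLatticeMassGap` never reads `z, shift`), so the landed infimum descent `exists_threshold_not_gapProp` (p134498) runs
  with FINITENESS discharged by contradiction and OPENNESS = mass continuation verbatim.
* `chiralDescent_of_sameRegChiralCompletion`, `chiralDescent_of_massContinuation_of_chiralTupleGapless`,
  `chiralCompletion_of_massContinuation_of_chiralTupleGapless` — the crux BY NAME (and item 17394) from those items,
  through the landed closer p137636.
* `gaplessBodyInfimum_iff_massContinuation`, `chiralPointOfBodyEverywhere_of_chiralTupleGapless` — the cycle-3 stubs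
  (the strategist's prepared children `GaplessBodyInfimum`, `ChiralPointOfBodyEverywhere`) against the existing items:
  H1 ⇔ item 18327 exactly (it would duplicate it), item 18328 ⇒ H2 (vacuously: a body everywhere would gap the gapless
  tuple).

All implications are CONDITIONAL on the named items (open-problem class: light-quark continuation of the construction below
a uniformly gapped offset + OS-level chiral gaplessness); that is the point — they are the ledger's dependency edges.
Pure logic over `QCDOS.lean`; standard axioms.
-/

namespace Summit.QuantumFields.QCD.Cruxes.ChiralDescent.InfimumDescent

open Filter
open Literature.MathematicalPhysics.QuantumFieldTheory
open Summit.QuantumFields.QCD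

variable {Nf : ℕ}

/-! ## §1 The crux is the shared item stmt-QuantumFields-17394 -/

/-- **`ChiralDescent` ⇔ `QuarksAsStableAction.ChiralCompletion`** (item stmt-QuantumFields-17394, shared with route
SeaNonGibbs): the two statements differ only in the order of the existential quantifiers `∃ reg` / `∃ M₀ ≥ 0` of the
threshold hypothesis. [folklore] -/
theorem chiralDescent_iff_chiralCompletion :
    Theses.SpectralDefectExtinction.ChiralDescent ↔ Theses.QuarksAsStableAction.ChiralCompletion := by
  unfold Theses.SpectralDefectExtinction.ChiralDescent Theses.QuarksAsStableAction.ChiralCompletion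
  constructor
  · rintro h Nf hNf ⟨M₀, hM₀, reg, hMS, hB⟩
    exact h Nf hNf ⟨reg, hMS, M₀, hM₀, hB⟩
  · rintro h Nf hNf ⟨reg, hMS, M₁, hM₁, hB⟩
    exact h Nf hNf ⟨M₁, hM₁, reg, hMS, hB⟩

/-! ## §2 E is the same-regularisation crux stmt-QuantumFields-17661 -/

/-- Translating a tuple down by `δ` and back up. [folklore] -/
theorem fun_sub_add_cancel (m : Fin Nf → ℝ) (δ : ℝ) : (fun f => m f - δ + δ) = m :=
  funext fun f => sub_add_cancel (m f) δ

/-- **E ⇔ `HeavyThresholdYMBridge.ChiralCompletion`** (item stmt-QuantumFields-17661, text verbatim on the right).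
E says: a mass-scaling regularisation with the body above some threshold has an offset `μ` with the body above `μ` and
no uniform lattice rate above `μ`; item 17661 says: some constant re-pin `m ↦ m + δ` of it is chiral at zero and carries
the body at every positive tuple.  `δ = μ`; the positive tuples of the re-pin are exactly the tuples above `μ`
(`fun_sub_add_cancel`). [folklore] -/
theorem chiralPointOfThreshold_iff_sameRegChiralCompletion :
    (∀ Nf : ℕ, (Nf = 2 ∨ Nf = 3) → ∀ reg : QCDRegularisation Nf, reg.HasMassScaling → ∀ M₁ : ℝ,
      (∀ m : Fin Nf → ℝ, (∀ f, M₁ < m f) →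
        ∃ (z shift : QCDField Nf → ℕ → ℝ) (T : OSData (QCDField Nf) 4),
          IsQCDAlong (reg.scheme m z shift) T ∧ T.IsNontrivial QCDField.glue ∧ T.IsNonGaussian QCDField.glue ∧
            (∀ f g : Fin Nf, f ≠ g → T.IsNontrivial (QCDField.pseudoRe f g)) ∧
              ∃ Δ > 0, T.HasMassGap Δ ∧ (reg.scheme m z shift).HasLatticeMassGap Δ) →
      ∃ μ : ℝ, (∀ m : Fin Nf → ℝ, (∀ f, μ < m f) →
        ∃ (z shift : QCDField Nf → ℕ → ℝ) (T : OSData (QCDField Nf) 4),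
          IsQCDAlong (reg.scheme m z shift) T ∧ T.IsNontrivial QCDField.glue ∧ T.IsNonGaussian QCDField.glue ∧
            (∀ f g : Fin Nf, f ≠ g → T.IsNontrivial (QCDField.pseudoRe f g)) ∧
              ∃ Δ > 0, T.HasMassGap Δ ∧ (reg.scheme m z shift).HasLatticeMassGap Δ) ∧
        ∀ ε > (0 : ℝ), ∃ m : Fin Nf → ℝ, (∀ f, μ < m f) ∧ ¬ (reg.scheme m 0 0).HasLatticeMassGap ε) ↔
    (∀ Nf : ℕ, Nf = 2 ∨ Nf = 3 → ∀ (reg : QCDRegularisation Nf) (M₀ : ℝ), reg.HasMassScaling →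
      (∀ m : Fin Nf → ℝ, (∀ f, M₀ < m f) →
        ∃ (z shift : QCDField Nf → ℕ → ℝ) (T : OSData (QCDField Nf) 4),
          IsQCDAlong (reg.scheme m z shift) T ∧ T.IsNontrivial QCDField.glue ∧ T.IsNonGaussian QCDField.glue ∧
            (∀ f g : Fin Nf, f ≠ g → T.IsNontrivial (QCDField.pseudoRe f g)) ∧
              ∃ Δ > 0, T.HasMassGap Δ ∧ (reg.scheme m z shift).HasLatticeMassGap Δ) →
      ∃ δ : ℝ, (∀ ε > (0 : ℝ), ∃ m : Fin Nf → ℝ, (∀ f, 0 < m f) ∧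
          ¬ (reg.scheme (fun f => m f + δ) 0 0).HasLatticeMassGap ε) ∧
        ∀ m : Fin Nf → ℝ, (∀ f, 0 < m f) →
          ∃ (z shift : QCDField Nf → ℕ → ℝ) (T : OSData (QCDField Nf) 4),
            IsQCDAlong (reg.scheme (fun f => m f + δ) z shift) T ∧ T.IsNontrivial QCDField.glue ∧
              T.IsNonGaussian QCDField.glue ∧
                (∀ f g : Fin Nf, f ≠ g → T.IsNontrivial (QCDField.pseudoRe f g)) ∧
                  ∃ Δ > 0, T.HasMassGap Δ ∧ (reg.scheme (fun f => m f + δ) z shift).HasLatticeMassGap Δ) := by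
  constructor
  · intro hE Nf hNf reg M₀ hMS hB
    obtain ⟨μ, hBμ, hGμ⟩ := hE Nf hNf reg hMS M₀ hB
    refine ⟨μ, fun ε hε => ?_, fun m hm => hBμ (fun f => m f + μ) fun f => lt_add_of_pos_left μ (hm f)⟩
    obtain ⟨m, hm, hng⟩ := hGμ ε hε
    refine ⟨fun f => m f - μ, fun f => sub_pos.mpr (hm f), ?_⟩
    rw [fun_sub_add_cancel]
    exact hng
  · intro h Nf hNf reg hMS M₁ hB
    obtain ⟨δ, hχ, hBδ⟩ := h Nf hNf reg M₁ hMS hB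
    refine ⟨δ, fun m hm => ?_, fun ε hε => ?_⟩
    · have hb := hBδ (fun f => m f - δ) fun f => sub_pos.mpr (hm f)
      rw [fun_sub_add_cancel] at hb
      exact hb
    · obtain ⟨m, hm, hng⟩ := hχ ε hε
      exact ⟨fun f => m f + δ, fun f => lt_add_of_pos_left δ (hm f), hng⟩

/-- **`ChiralDescent` from item stmt-QuantumFields-17661** (`HeavyThresholdYMBridge.ChiralCompletion`, text verbatim as
the hypothesis): through E and the landed closer `chiralDescent_of_chiralPointOfThreshold` (p137636). CONDITIONAL on that
item (open-problem class). [folklore] -/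
theorem chiralDescent_of_sameRegChiralCompletion
    (h : ∀ Nf : ℕ, Nf = 2 ∨ Nf = 3 → ∀ (reg : QCDRegularisation Nf) (M₀ : ℝ), reg.HasMassScaling →
      (∀ m : Fin Nf → ℝ, (∀ f, M₀ < m f) →
        ∃ (z shift : QCDField Nf → ℕ → ℝ) (T : OSData (QCDField Nf) 4),
          IsQCDAlong (reg.scheme m z shift) T ∧ T.IsNontrivial QCDField.glue ∧ T.IsNonGaussian QCDField.glue ∧
            (∀ f g : Fin Nf, f ≠ g → T.IsNontrivial (QCDField.pseudoRe f g)) ∧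
              ∃ Δ > 0, T.HasMassGap Δ ∧ (reg.scheme m z shift).HasLatticeMassGap Δ) →
      ∃ δ : ℝ, (∀ ε > (0 : ℝ), ∃ m : Fin Nf → ℝ, (∀ f, 0 < m f) ∧
          ¬ (reg.scheme (fun f => m f + δ) 0 0).HasLatticeMassGap ε) ∧
        ∀ m : Fin Nf → ℝ, (∀ f, 0 < m f) →
          ∃ (z shift : QCDField Nf → ℕ → ℝ) (T : OSData (QCDField Nf) 4),
            IsQCDAlong (reg.scheme (fun f => m f + δ) z shift) T ∧ T.IsNontrivial QCDField.glue ∧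
              T.IsNonGaussian QCDField.glue ∧
                (∀ f g : Fin Nf, f ≠ g → T.IsNontrivial (QCDField.pseudoRe f g)) ∧
                  ∃ Δ > 0, T.HasMassGap Δ ∧ (reg.scheme (fun f => m f + δ) z shift).HasLatticeMassGap Δ) :
    Summit.QuantumFields.QCD.Theses.SpectralDefectExtinction.ChiralDescent :=
  chiralDescent_of_chiralPointOfThreshold (chiralPointOfThreshold_iff_sameRegChiralCompletion.mpr h)

/-! ## §3 E from mass continuation and a gapless tuple (items stmt-QuantumFields-18327, 18328) -/

/-- **E from `MassContinuation` ∧ `ChiralTupleGapless`** (items stmt-QuantumFields-18327 and 18328 of route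
QuarksAsStableAction, by name).  For the threshold regularisation `reg` let `S = {μ | body above μ}` (an up-set containing
`M₁`).  The gapless tuple `m₀` of item 18328 cannot carry the body (the body at `m₀` would give a rate `Δ > 0` for
`reg.scheme m₀ z shift`, whose lattice-gap clause is literally that of `reg.scheme m₀ 0 0`), so "body at every tuple" is
contradictory and the FINITENESS branch of the landed infimum descent `exists_threshold_not_gapProp` (p134498) is
discharged; its OPENNESS hypothesis is item 18327 verbatim.  The descent returns an offset with the body above it and no
uniform rate. CONDITIONAL on the two items (open-problem class). [folklore] -/
theorem chiralPointOfThreshold_of_massContinuation_of_chiralTupleGapless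
    (hO : Theses.QuarksAsStableAction.MassContinuation) (hG : Theses.QuarksAsStableAction.ChiralTupleGapless) :
    ∀ Nf : ℕ, (Nf = 2 ∨ Nf = 3) → ∀ reg : QCDRegularisation Nf, reg.HasMassScaling → ∀ M₁ : ℝ,
      (∀ m : Fin Nf → ℝ, (∀ f, M₁ < m f) →
        ∃ (z shift : QCDField Nf → ℕ → ℝ) (T : OSData (QCDField Nf) 4),
          IsQCDAlong (reg.scheme m z shift) T ∧ T.IsNontrivial QCDField.glue ∧ T.IsNonGaussian QCDField.glue ∧
            (∀ f g : Fin Nf, f ≠ g → T.IsNontrivial (QCDField.pseudoRe f g)) ∧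
              ∃ Δ > 0, T.HasMassGap Δ ∧ (reg.scheme m z shift).HasLatticeMassGap Δ) →
      ∃ μ : ℝ, (∀ m : Fin Nf → ℝ, (∀ f, μ < m f) →
        ∃ (z shift : QCDField Nf → ℕ → ℝ) (T : OSData (QCDField Nf) 4),
          IsQCDAlong (reg.scheme m z shift) T ∧ T.IsNontrivial QCDField.glue ∧ T.IsNonGaussian QCDField.glue ∧
            (∀ f g : Fin Nf, f ≠ g → T.IsNontrivial (QCDField.pseudoRe f g)) ∧
              ∃ Δ > 0, T.HasMassGap Δ ∧ (reg.scheme m z shift).HasLatticeMassGap Δ) ∧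
        ∀ ε > (0 : ℝ), ∃ m : Fin Nf → ℝ, (∀ f, μ < m f) ∧ ¬ (reg.scheme m 0 0).HasLatticeMassGap ε := by
  unfold Theses.QuarksAsStableAction.MassContinuation at hO
  unfold Theses.QuarksAsStableAction.ChiralTupleGapless at hG
  intro Nf hNf reg hMS M₁ hbody
  have hNf0 : 0 < Nf := by rcases hNf with rfl | rfl <;> norm_num
  obtain ⟨μ, hB, hGμ⟩ := exists_threshold_not_gapProp hNf0
    (fun m => ∃ (z shift : QCDField Nf → ℕ → ℝ) (T : OSData (QCDField Nf) 4),
      IsQCDAlong (reg.scheme m z shift) T ∧ T.IsNontrivial QCDField.glue ∧ T.IsNonGaussian QCDField.glue ∧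
        (∀ f g : Fin Nf, f ≠ g → T.IsNontrivial (QCDField.pseudoRe f g)) ∧
          ∃ Δ > 0, T.HasMassGap Δ ∧ (reg.scheme m z shift).HasLatticeMassGap Δ)
    (fun μ => ∃ ε > (0 : ℝ), ∀ m : Fin Nf → ℝ, (∀ f, μ < m f) → (reg.scheme m 0 0).HasLatticeMassGap ε)
    (fun μ hBμ hgap => by
      obtain ⟨ε, hε, hgap⟩ := hgap
      exact hO Nf hNf reg μ ε hMS hε hBμ hgap)
    (fun hall => by
      exfalso
      obtain ⟨m₀, hm₀⟩ := hG Nf hNf reg M₁ hMS hbody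
      obtain ⟨z, shift, T, -, -, -, -, Δ, hΔ, -, hL⟩ := hall m₀
      -- `HasLatticeMassGap` never reads `z, shift`: the clause of `reg.scheme m₀ z shift` IS that of `reg.scheme m₀ 0 0`
      exact hm₀ Δ hΔ hL)
    hbody
  refine ⟨μ, hB, fun ε hε => ?_⟩
  by_contra hno
  push Not at hno
  exact hGμ ⟨ε, hε, hno⟩

/-- **`ChiralDescent` from items stmt-QuantumFields-18327 ∧ 18328** (`QuarksAsStableAction.MassContinuation`,
`QuarksAsStableAction.ChiralTupleGapless`), through E and the landed closer p137636. CONDITIONAL on the two items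
(open-problem class). [folklore] -/
theorem chiralDescent_of_massContinuation_of_chiralTupleGapless
    (hO : Summit.QuantumFields.QCD.Theses.QuarksAsStableAction.MassContinuation)
    (hG : Summit.QuantumFields.QCD.Theses.QuarksAsStableAction.ChiralTupleGapless) :
    Summit.QuantumFields.QCD.Theses.SpectralDefectExtinction.ChiralDescent :=
  chiralDescent_of_chiralPointOfThreshold (chiralPointOfThreshold_of_massContinuation_of_chiralTupleGapless hO hG)

/-- **The shared item from the two pieces, in this packaging** (`QuarksAsStableAction.ChiralCompletion`, item 17394, from
items 18327 ∧ 18328; the sibling line `Cruxes/StableActionBridge/Lines/least_threshold.lean` proves the same edge by its own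
least-threshold lemma — recorded here so that the three routes' chiral nodes are ONE debt on the ledger). CONDITIONAL
(open-problem class). [folklore] -/
theorem chiralCompletion_of_massContinuation_of_chiralTupleGapless
    (hO : Theses.QuarksAsStableAction.MassContinuation) (hG : Theses.QuarksAsStableAction.ChiralTupleGapless) :
    Theses.QuarksAsStableAction.ChiralCompletion :=
  chiralDescent_iff_chiralCompletion.mp (chiralDescent_of_massContinuation_of_chiralTupleGapless hO hG)

/-! ## §4 The cycle-3 stubs H1, H2 against the existing items -/

/-- **H1 (`stub_gaplessBodyInfimum`, the strategist's child `GaplessBodyInfimum`) ⇔ item stmt-QuantumFields-18327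
`QuarksAsStableAction.MassContinuation`.**  Per regularisation, "no uniform rate at a minimum of the body up-set" is
OPENNESS (`openness_of_gaplessBodyInfimum` / `gaplessBodyInfimum_of_openness`, p137636), and openness with the rate `ε`
curried out is mass continuation verbatim.  So the child H1 would DUPLICATE item 18327. [folklore] -/
theorem gaplessBodyInfimum_iff_massContinuation :
    (∀ Nf : ℕ, (Nf = 2 ∨ Nf = 3) → ∀ reg : QCDRegularisation Nf, reg.HasMassScaling → ∀ μ : ℝ,
      (∀ m : Fin Nf → ℝ, (∀ f, μ < m f) →
        ∃ (z shift : QCDField Nf → ℕ → ℝ) (T : OSData (QCDField Nf) 4),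
          IsQCDAlong (reg.scheme m z shift) T ∧ T.IsNontrivial QCDField.glue ∧ T.IsNonGaussian QCDField.glue ∧
            (∀ f g : Fin Nf, f ≠ g → T.IsNontrivial (QCDField.pseudoRe f g)) ∧
              ∃ Δ > 0, T.HasMassGap Δ ∧ (reg.scheme m z shift).HasLatticeMassGap Δ) →
      (∀ μ' < μ, ¬ ∀ m : Fin Nf → ℝ, (∀ f, μ' < m f) →
        ∃ (z shift : QCDField Nf → ℕ → ℝ) (T : OSData (QCDField Nf) 4),
          IsQCDAlong (reg.scheme m z shift) T ∧ T.IsNontrivial QCDField.glue ∧ T.IsNonGaussian QCDField.glue ∧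
            (∀ f g : Fin Nf, f ≠ g → T.IsNontrivial (QCDField.pseudoRe f g)) ∧
              ∃ Δ > 0, T.HasMassGap Δ ∧ (reg.scheme m z shift).HasLatticeMassGap Δ) →
      ∀ ε > (0 : ℝ), ∃ m : Fin Nf → ℝ, (∀ f, μ < m f) ∧ ¬ (reg.scheme m 0 0).HasLatticeMassGap ε) ↔
    Theses.QuarksAsStableAction.MassContinuation := by
  unfold Theses.QuarksAsStableAction.MassContinuation
  constructor
  · intro h1 Nf hNf reg M ε hMS hε hB hgap
    exact openness_of_gaplessBodyInfimum
      (fun m => ∃ (z shift : QCDField Nf → ℕ → ℝ) (T : OSData (QCDField Nf) 4),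
        IsQCDAlong (reg.scheme m z shift) T ∧ T.IsNontrivial QCDField.glue ∧ T.IsNonGaussian QCDField.glue ∧
          (∀ f g : Fin Nf, f ≠ g → T.IsNontrivial (QCDField.pseudoRe f g)) ∧
            ∃ Δ > 0, T.HasMassGap Δ ∧ (reg.scheme m z shift).HasLatticeMassGap Δ)
      (fun ε m => (reg.scheme m 0 0).HasLatticeMassGap ε)
      (h1 Nf hNf reg hMS) M hB ⟨ε, hε, hgap⟩
  · intro hO Nf hNf reg hMS μ hB hmin
    exact gaplessBodyInfimum_of_openness
      (fun m => ∃ (z shift : QCDField Nf → ℕ → ℝ) (T : OSData (QCDField Nf) 4),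
        IsQCDAlong (reg.scheme m z shift) T ∧ T.IsNontrivial QCDField.glue ∧ T.IsNonGaussian QCDField.glue ∧
          (∀ f g : Fin Nf, f ≠ g → T.IsNontrivial (QCDField.pseudoRe f g)) ∧
            ∃ Δ > 0, T.HasMassGap Δ ∧ (reg.scheme m z shift).HasLatticeMassGap Δ)
      (fun ε m => (reg.scheme m 0 0).HasLatticeMassGap ε)
      (fun μ' hB' hG' => by
        obtain ⟨ε, hε, hgap⟩ := hG'
        exact hO Nf hNf reg μ' ε hMS hε hB' hgap)
      μ hB hmin

/-- **Item stmt-QuantumFields-18328 `QuarksAsStableAction.ChiralTupleGapless` ⇒ H2 (`stub_chiralPointOfBodyEverywhere`, the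
strategist's child `ChiralPointOfBodyEverywhere`)** — vacuously: a body at EVERY tuple would gap the gapless tuple
(`HasLatticeMassGap` never reads `z, shift`).  So the child H2 is a WEAKER cousin of item 18328. [folklore] -/
theorem chiralPointOfBodyEverywhere_of_chiralTupleGapless (hG : Theses.QuarksAsStableAction.ChiralTupleGapless) :
    ∀ Nf : ℕ, (Nf = 2 ∨ Nf = 3) → ∀ reg : QCDRegularisation Nf, reg.HasMassScaling →
      (∀ m : Fin Nf → ℝ,
        ∃ (z shift : QCDField Nf → ℕ → ℝ) (T : OSData (QCDField Nf) 4),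
          IsQCDAlong (reg.scheme m z shift) T ∧ T.IsNontrivial QCDField.glue ∧ T.IsNonGaussian QCDField.glue ∧
            (∀ f g : Fin Nf, f ≠ g → T.IsNontrivial (QCDField.pseudoRe f g)) ∧
              ∃ Δ > 0, T.HasMassGap Δ ∧ (reg.scheme m z shift).HasLatticeMassGap Δ) →
      ∃ μ : ℝ, ∀ ε > (0 : ℝ), ∃ m : Fin Nf → ℝ, (∀ f, μ < m f) ∧ ¬ (reg.scheme m 0 0).HasLatticeMassGap ε := by
  unfold Theses.QuarksAsStableAction.ChiralTupleGapless at hG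
  intro Nf hNf reg hMS hall
  exfalso
  obtain ⟨m₀, hm₀⟩ := hG Nf hNf reg 0 hMS fun m _ => hall m
  obtain ⟨z, shift, T, -, -, -, -, Δ, hΔ, -, hL⟩ := hall m₀
  exact hm₀ Δ hΔ hL

end Summit.QuantumFields.QCD.Cruxes.ChiralDescent.InfimumDescent
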